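import Summits.BirchSwinnertonDyer.BirchSwinnertonDyer.Theorems.ByReductionTypeAtTwoOrdKatoHalfAtTwoIsoGreenbergMuDefs
import Literature.NumberTheory.EllipticCurves.KatoRankBoundProofs
import HarnessLib

/-!
# Cert52a — crux-triage r1-2 GEN 52 (independent seat 2/2), crux `ByReductionTypeAtTwo.OrdKatoHalfAtTwoIso`
# (item stmt-BirchSwinnertonDyer-19573), line `steinberg-fibre-at-two`, skeleton of record v24 `4921f2ec…`.

NON-VACUITY OF THE IWASAWA BINDER PREFIX of the registered research stub
`stub_greenbergMu_two_posDisc : SteinbergFibreAtTwo.GreenbergMuZeroTwoOrdPosDisc` (G11⁺, p733065), in the KERNEL and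
ROUTE-FILE-FREE: the prefix «`∀ κ γ, κ.IsCyclotomic → κ.IsTopGenerator γ → IsCyclotomicVariable 2 γ → ∀ D : W.SelmerDualData κ γ`»
is INHABITED at every elliptic `W/ℚ` by the tree's constructions
(`Literature.NumberTheory.EllipticCurves.exists_isCyclotomic_isTopGenerator_isCyclotomicVariable_holds`, KatoRankBoundProofs;
`WeierstrassCurve.nonempty_selmerDualData_holds`, IwasawaSelmerDualProofs — both sorry-free kernel theorems), so G11⁺ is NOT
satisfiable «for lack of data»: at every cell curve it yields `D.mu = 0` for a GENUINE cyclotomic datum (`g11_instance`).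
The same prefix heads the crux conclusion `X5.O1.MainConjectureLowerDivisibilityAtTwoOrd`, so prefix-(non)vacuity is shared by
the stub and the conjunct it replaces — the v24 merge cannot gain or lose through it. Certifies an implication between displayed
statements only; asserts nothing; BSD is NOT proved; G11⁺ and the crux are OPEN.
-/

set_option autoImplicit false
set_option linter.dupNamespace false

open Literature.NumberTheory.EllipticCurves Literature.NumberTheory.EllipticCurves.Rank1Residual
open Literature.NumberTheory.GaloisRepresentations WeierstrassCurve
open Summit.BirchSwinnertonDyer.BirchSwinnertonDyer.Theorems.SteinbergFibreAtTwo

namespace Summit.BirchSwinnertonDyer.BirchSwinnertonDyer.Cruxes.OrdKatoHalfAtTwoIso.Cert52a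

/-- The Iwasawa binder prefix of G11⁺ at `p = 2` is inhabited at every `W/ℚ` (kernel: the constructed cyclotomic
`ℤ₂`-extension, a topological generator matching the cyclotomic variable, and the Pontryagin-dual datum). [folklore] -/
theorem prefix_inhabited_two (W : WeierstrassCurve ℚ) :
    ∃ (κ : ZpExtension ℚ 2) (γ : Field.absoluteGaloisGroup ℚ),
      κ.IsCyclotomic ∧ κ.IsTopGenerator γ ∧ IsCyclotomicVariable 2 γ ∧ Nonempty (W.SelmerDualData κ γ) := by
  obtain ⟨κ, hκ, γ, hγ, hγ'⟩ := exists_isCyclotomic_isTopGenerator_isCyclotomicVariable_holds 2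
  exact ⟨κ, γ, hκ, hγ, hγ', W.nonempty_selmerDualData_holds κ γ hγ⟩

/-- G11⁺ has a NON-VACUOUS instance at every cell curve: it produces `μ = 0` for SOME genuine cyclotomic dual datum
(so «G11⁺ true for lack of (κ, γ, D)» is excluded in the kernel). [folklore] -/
theorem g11_instance (h : GreenbergMuZeroTwoOrdPosDisc)
    (W : WeierstrassCurve ℚ) [W.IsElliptic] [W.IsGloballyMinimal] (hcm : ¬ W.HasCM) (hr : W.analyticRank = 0)
    (hgo : GoodOrd W 2) (h2 : W.HasSurjectiveModNGaloisRep 2) (hΔ : 0 < W.Δ) :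
    ∃ (κ : ZpExtension ℚ 2) (γ : Field.absoluteGaloisGroup ℚ) (D : W.SelmerDualData κ γ),
      κ.IsCyclotomic ∧ κ.IsTopGenerator γ ∧ IsCyclotomicVariable 2 γ ∧ D.mu = 0 := by
  obtain ⟨κ, γ, hκ, hγ, hγ', ⟨D⟩⟩ := prefix_inhabited_two W
  exact ⟨κ, γ, D, hκ, hγ, hγ', h W hcm hr hgo h2 hΔ κ γ hκ hγ hγ' D⟩

end Summit.BirchSwinnertonDyer.BirchSwinnertonDyer.Cruxes.OrdKatoHalfAtTwoIso.Cert52a
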